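import Mathlib
import Literature.Analysis.FluidPDE.SelfSimilarEulerProfile
import Literature.Analysis.FluidPDE.SelfSimilarEulerOutgoingExclusionTools
import Literature.NumberTheory.LFunctions.NicolasMertensRHProofs
import Summits.NavierStokesRegularity.NavierStokesRegularity.Theorems.EulerZoomLiouvillePowerGaugeEulerLiouvilleChannelClockTools
import Summits.NavierStokesRegularity.NavierStokesRegularity.Theorems.EulerZoomLiouvillePowerGaugeEulerLiouvilleDriftClockShellTools
import Summits.NavierStokesRegularity.NavierStokesRegularity.Theorems.EulerZoomLiouvillePowerGaugeEulerLiouvilleSelfSimilarVorticalEscape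
import Summits.NavierStokesRegularity.NavierStokesRegularity.Theorems.EulerZoomLiouvillePowerGaugeEulerLiouvilleOutflowDiveVorticityTransport
import HarnessLib

/-!
# «ANY INWARD DRIFT KILLS», VIII (class-free, LEVEL-FREE ENGINE, T-H′): a band deficit carried by ANY backward-invariant open region clocks every vortical ball inside it
# (crux `EulerZoomLiouville.PowerGaugeEulerLiouville` = stmt-NavierStokesRegularity-19832, THE ONE STATEMENT `stub_selfSimilarC2Needle`; feeds `HasResidenceClock` alt 6 «one clocked ball», LEAD v88)

Route `EulerZoomLiouville` (NavierStokesRegularity), crux E; width seat ns-ezl-w1 g6.  The T-H engine `DriftClock.powerClock_of_scaleBandDeficit`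
(`…DriftClockScale`) asks for the scale-indexed band deficit at the far VORTICAL points of a BERNOULLI SUPER-LEVEL SET `{ℋ_{P′} > h}`; the level set enters
the proof only through (i) openness and (ii) backward invariance along similarity orbits (`bernoulli_le_of_arc`, `γ ≤ ½`).  Here the level set is replaced by
an ARBITRARY OPEN SET `O` that is BACKWARD-INVARIANT for the true similarity flow — every `C¹` arc `Z` on `[0, t]` with `Z′ = −W(Z)` and `Z(0) ∈ O` ends in
`O` — and carries the deficit beyond a radius `Rf`: at every scale `R`, every vortical `y ∈ O` with `Rf ≤ ‖y‖ ≤ 2R` and `−κ(R) ≤ ℛ(y) ≤ 0` has `a(y) ≥ a(R)`,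
with the budget `2κ(R)/a(R) + 3R²/κ(R) ≤ c′R^{2+ρ}` eventually (`W y = γy + V y`, `γ = 1/(2+ρ)`, `ℛ = ⟪y, W y⟫`, `a(y) = ‖W y‖² + γℛ + ⟪y, DV(y)(W y)⟫`).
CONCLUSION: the POWER residence clock AT EVERY VORTICAL `x₀ ∈ O` (for every `c′ > 0` a ball `B(x₀, r)` at most half of whose labels linger in `‖·‖ ≤ 2R`
for backward similarity time `c′R^{2+ρ}`, all large `R`, every cut-off copy) — the `∃ x₀ r …` hypothesis of the LEAD's
`NeedleRace.selfSimilar_ae_eq_zero_of_localPowerClockC2` / `…_past` («one clocked ball kills», v88).  No pressure and no Bernoulli level appear in the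
hypotheses: a mechanism region (invariant far inflow cone, sector, tube…) need not be a super-level set of `ℋ`.

* `DriftClock.powerClockAt_of_invariantBandDeficit` — the level-free engine (proof = the engine's, with `{ℋ > h}` ↦ `O`; the shell bootstrap
  `DriftClock.abs_band_bootstrap_shell`, whose level/pressure slots are free, is fed the indicator `𝟙_O` as a formal Bernoulli function).
  Instance `O = {ℋ_{P′} > h}` (open, backward-invariant by `bernoulli_le_of_arc`) = `DriftClock.powerClock_of_scaleBandDeficit` at level `h`.

WHAT THIS IS NOT: not NS, not E — a class-free ODE/measure lemma about `C²` profiles (no budgets), `--supports` stmt-19832; the crux is OPEN;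
NS regularity is NOT proved. [folklore; cf. ConstantinIgnatovaVicol2026Putative §3.4 (3.19)–(3.22), §3.5]
-/
noncomputable section

-- flat `Theorems/<Route><Decl>…` files of one crux share the namespace of the crux (tree convention: `Summit.<S>.<S>.…`)
set_option linter.dupNamespace false

open Set Filter Topology Metric MeasureTheory
open scoped RealInnerProductSpace ENNReal

namespace Summit.NavierStokesRegularity.NavierStokesRegularity.Theorems.PowerGaugeEulerLiouville

open Literature.Analysis Literature.Analysis.FluidPDE

namespace DriftClock

open ChannelClock

/-- **Bernoulli super-level sets are backward-invariant for the similarity flow** (`γ ≤ ½`): along a `C¹` arc `Z′ = −W(Z)` on `[0, t]` the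
Bernoulli function does not decrease (`bernoulli_le_of_arc`), so `{ℋ_{P′} > h}` is an admissible region `O` of
`DriftClock.powerClockAt_of_invariantBandDeficit` (and so is its intersection with any other backward-invariant open set).
[folklore; ConstantinIgnatovaVicol2026Putative §3.4.3 (3.31)] -/
theorem backwardInvariant_bernoulliSuperlevel {γ : ℝ} {V : EuclideanSpace ℝ (Fin 3) → EuclideanSpace ℝ (Fin 3)}
    {P' : EuclideanSpace ℝ (Fin 3) → ℝ} (hprof : IsSelfSimilarEulerProfile γ 0 V P') (hγ2 : γ ≤ 1 / 2) (h : ℝ) :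
    ∀ (Z : ℝ → EuclideanSpace ℝ (Fin 3)) (t : ℝ), 0 ≤ t →
      (∀ s ∈ Icc 0 t, HasDerivAt Z (-(selfSimilarTransport γ 0 V (Z s))) s) →
      Z 0 ∈ {y | h < selfSimilarBernoulli γ 0 V P' y} → Z t ∈ {y | h < selfSimilarBernoulli γ 0 V P' y} :=
  fun _ _ ht hZ h0 => lt_of_lt_of_le h0 (bernoulli_le_of_arc hprof hγ2 ht hZ)

/-- **«ANY INWARD DRIFT KILLS», LEVEL-FREE (T-H′ engine): an open set `O`, backward-invariant for the similarity flow, carrying the scale-indexed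
band deficit (`a ≥ a(R)` on `−κ(R) ≤ ℛ ≤ 0` at the vortical points of `O` with `Rf ≤ ‖y‖ ≤ 2R`) with budget `2κ(R)/a(R) + 3R²/κ(R) ≤ c′R^{2+ρ}`
eventually, CLOCKS EVERY VORTICAL `x₀ ∈ O`** (conclusion = the power residence clock at `x₀`, every `c′ > 0`; feeds
`NeedleRace.selfSimilar_ae_eq_zero_of_localPowerClockC2`). [folklore; cf. ConstantinIgnatovaVicol2026Putative §3.4–§3.5] -/
theorem powerClockAt_of_invariantBandDeficit {ρ : ℝ} (hρ : 0 < ρ) (hρh : ρ ≤ 1 / 2)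
    {V : EuclideanSpace ℝ (Fin 3) → EuclideanSpace ℝ (Fin 3)} {P' : EuclideanSpace ℝ (Fin 3) → ℝ}
    (hprof : IsSelfSimilarEulerProfile (1 / (2 + ρ)) 0 V P') {O : Set (EuclideanSpace ℝ (Fin 3))} (hO : IsOpen O)
    (hinv : ∀ (Z : ℝ → EuclideanSpace ℝ (Fin 3)) (t : ℝ), 0 ≤ t →
      (∀ s ∈ Icc 0 t, HasDerivAt Z (-(selfSimilarTransport (1 / (2 + ρ)) 0 V (Z s))) s) → Z 0 ∈ O → Z t ∈ O)
    {κ a : ℝ → ℝ} (hκ : ∀ R : ℝ, 0 < R → 0 < κ R) (ha : ∀ R : ℝ, 0 < R → 0 < a R) {Rf : ℝ}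
    (hdef : ∀ (R : ℝ) (y : EuclideanSpace ℝ (Fin 3)), y ∈ O → Rf ≤ ‖y‖ → ‖y‖ ≤ 2 * R → curl V y ≠ 0 →
        -κ R ≤ ⟪y, selfSimilarTransport (1 / (2 + ρ)) 0 V y⟫ → ⟪y, selfSimilarTransport (1 / (2 + ρ)) 0 V y⟫ ≤ 0 →
        a R ≤ ‖selfSimilarTransport (1 / (2 + ρ)) 0 V y‖ ^ 2 +
          (1 / (2 + ρ)) * ⟪y, selfSimilarTransport (1 / (2 + ρ)) 0 V y⟫ +
          ⟪y, fderiv ℝ V y (selfSimilarTransport (1 / (2 + ρ)) 0 V y)⟫)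
    (hbudget : ∀ c' : ℝ, 0 < c' → ∀ᶠ R : ℝ in atTop, 2 * κ R / a R + 3 * R ^ 2 / κ R ≤ c' * R ^ (2 + ρ))
    {x₀ : EuclideanSpace ℝ (Fin 3)} (hx₀O : x₀ ∈ O) (hx₀ : curl V x₀ ≠ 0) :
    ∀ c' : ℝ, 0 < c' → ∃ r : ℝ, 0 < r ∧ ∃ R₀ : ℝ,
      ∀ R : ℝ, R₀ ≤ R → ∀ (V' : EuclideanSpace ℝ (Fin 3) → EuclideanSpace ℝ (Fin 3)) (K Rbig : ℝ), ContDiff ℝ 2 V' →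
        (∀ y, ‖fderiv ℝ V' y‖ ≤ K) → 2 * R < Rbig →
        (∀ w ∈ ball (0 : EuclideanSpace ℝ (Fin 3)) Rbig, V' w = V w) →
        (volume (ball x₀ r ∩ {y | ∀ σ ∈ Icc 0 (c' * R ^ (2 + ρ)),
          ‖ODE.evolutionMap (fun _ : ℝ => selfSimilarTransport (1 / (2 + ρ)) 0 V') 0 (-σ) y‖ ≤ 2 * R})).toReal ≤
          (volume (ball x₀ r)).toReal / 2 := by
  intro c' hc'
  set γ : ℝ := 1 / (2 + ρ) with hγdef
  have h2ρ : (0 : ℝ) < 2 + ρ := by linarith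
  have hγ : 0 < γ := one_div_pos.2 h2ρ
  have hγ2 : γ < 1 / 2 := one_div_lt_one_div_of_lt two_pos (by linarith)
  have hU2 : ContDiff ℝ 2 V := hprof.contDiff_velocity
  -- ### the blob: a small ball inside `O ∩ {curl ≠ 0}`
  have hcurlc : Continuous (curl V) := (differentiable_curl_of_contDiff hU2).continuous
  have hOopen : IsOpen (O ∩ {y : EuclideanSpace ℝ (Fin 3) | curl V y ≠ 0}) :=
    hO.inter (isOpen_ne_fun hcurlc continuous_const)
  obtain ⟨r₀, hr₀, hball₀⟩ := Metric.isOpen_iff.1 hOopen x₀ ⟨hx₀O, hx₀⟩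
  -- the DUMMY pressure `P₀` with `ℋ_{P₀} = 𝟙_O`, so that `{½ < ℋ_{P₀}} = O` (to feed `DriftClock.abs_band_bootstrap_shell`, whose level is free)
  set P₀ : EuclideanSpace ℝ (Fin 3) → ℝ := fun y => O.indicator (fun _ => (1 : ℝ)) y -
    ((1 / 2 : ℝ) * ‖γ • (y - 0) + V y‖ ^ 2 + γ * (γ - 1) / 2 * ‖y - 0‖ ^ 2) with hP₀def
  have hHO : ∀ y : EuclideanSpace ℝ (Fin 3), (1 / 2 : ℝ) < selfSimilarBernoulli γ 0 V P₀ y ↔ y ∈ O := by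
    intro y
    have e : selfSimilarBernoulli γ 0 V P₀ y = O.indicator (fun _ => (1 : ℝ)) y := by
      rw [selfSimilarBernoulli_apply, hP₀def]; ring
    rw [e]
    by_cases hy : y ∈ O
    · rw [Set.indicator_of_mem hy]; simp only [hy, iff_true]; norm_num
    · rw [Set.indicator_of_notMem hy]; simp only [hy, iff_false, not_lt]; norm_num
  set r : ℝ := min r₀ 1 with hrdef
  have hr : 0 < r := lt_min hr₀ one_pos
  have hr1 : r ≤ 1 := min_le_right _ _
  have hballO : ∀ y ∈ ball x₀ r, y ∈ O ∧ curl V y ≠ 0 :=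
    fun y hy => hball₀ (ball_subset_ball (min_le_left _ _) hy)
  -- ### the far threshold `R₁` of the deficit, and the hitting radius `R_* ≥ 2R₁`
  set R₁ : ℝ := max Rf 1 with hR₁def
  have hR₁pos : 0 < R₁ := lt_of_lt_of_le one_pos (le_max_right _ _)
  have hfar : ∀ (R : ℝ) (y : EuclideanSpace ℝ (Fin 3)), R₁ ≤ ‖y‖ → ‖y‖ ≤ 2 * R → (1 / 2 : ℝ) < selfSimilarBernoulli γ 0 V P₀ y →
      curl V y ≠ 0 → -κ R ≤ ⟪y, selfSimilarTransport γ 0 V y⟫ → ⟪y, selfSimilarTransport γ 0 V y⟫ ≤ 0 →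
      a R ≤ ‖selfSimilarTransport γ 0 V y‖ ^ 2 + γ * ⟪y, selfSimilarTransport γ 0 V y⟫ +
        ⟪y, fderiv ℝ V y (selfSimilarTransport γ 0 V y)⟫ :=
    fun R y hy hy2 hh hc hlo hhi => hdef R y ((hHO y).1 hh) (le_trans (le_max_left _ _) hy) hy2 hc hlo hhi
  set Rs : ℝ := max (2 * R₁) (‖x₀‖ + 2) with hRsdef
  have hRs2R₁ : 2 * R₁ ≤ Rs := le_max_left _ _
  have hR₁1 : 1 ≤ R₁ := le_max_right _ _
  have hRs1 : 1 ≤ Rs := le_trans (by linarith) hRs2R₁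
  have hRspos : 0 < Rs := by linarith
  have hballRs : ∀ y ∈ ball x₀ r, ‖y‖ < Rs - 1 := by
    intro y hy
    have h1 : dist y x₀ < r := mem_ball.1 hy
    have h2 : ‖y‖ ≤ dist y x₀ + ‖x₀‖ := by
      have := dist_triangle y x₀ 0
      rwa [dist_zero_right, dist_zero_right] at this
    linarith [le_max_right (2 * R₁) (‖x₀‖ + 2)]
  -- ### the R-independent cut-off orbit and the near-confinement sets
  obtain ⟨V₀, hV₀, -, -, ⟨K₀, hK₀⟩, hagree₀⟩ := Loc.exists_cutoff_local hU2 (R := Rs + 1) (by linarith)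
  have hV₀1 : ContDiff ℝ 1 V₀ := hV₀.of_le (by norm_num)
  have hW₀eq : ∀ z : EuclideanSpace ℝ (Fin 3), ‖z‖ < Rs + 1 → selfSimilarTransport γ 0 V₀ z = selfSimilarTransport γ 0 V z := by
    intro z hz
    simp only [selfSimilarTransport_apply, hagree₀ z (by rwa [mem_ball, dist_zero_right])]
  set Φ₀ := ODE.evolutionMap (fun _ : ℝ => selfSimilarTransport γ 0 V₀) 0 with hΦ₀
  set Sn : ℕ → Set (EuclideanSpace ℝ (Fin 3)) := fun n =>
    ball x₀ r ∩ {y | ∀ σ ∈ Icc (0 : ℝ) n, ‖Φ₀ (-σ) y‖ ≤ Rs} with hSndef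
  have hSn_meas : ∀ n, MeasurableSet (Sn n) := by
    intro n
    refine measurableSet_ball.inter (IsClosed.measurableSet ?_)
    have : {y : EuclideanSpace ℝ (Fin 3) | ∀ σ ∈ Icc (0 : ℝ) n, ‖Φ₀ (-σ) y‖ ≤ Rs} =
        ⋂ σ ∈ Icc (0 : ℝ) n, {y | ‖Φ₀ (-σ) y‖ ≤ Rs} := by ext y; simp
    rw [this]
    refine isClosed_biInter fun σ _ => ?_
    exact isClosed_le ((C2.Kelvin.contDiff_flow (γ := γ) hV₀ hK₀ (-σ)).continuous.norm) continuous_const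
  have hSn_anti : Antitone Sn := by
    intro m n hmn y hy
    refine ⟨hy.1, fun σ hσ => hy.2 σ ⟨hσ.1, le_trans hσ.2 (by exact_mod_cast hmn)⟩⟩
  -- the intersection is inside the confined vortical set, null by W3b
  have hInter_null : volume (⋂ n, Sn n) = 0 := by
    refine measure_mono_null ?_ (Loc.volume_vortical_confined_eq_zero hprof hγ hγ2 hRspos)
    intro y hy
    rw [mem_iInter] at hy
    have hy0 : y ∈ ball x₀ r := (hy 0).1
    refine ⟨(hballO y hy0).2, fun t => Φ₀ (-t) y, by simp [hΦ₀, ODE.evolutionMap_self], ?_, ?_⟩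
    · intro t ht
      have hconf : ‖Φ₀ (-t) y‖ ≤ Rs := by
        obtain ⟨n, hn⟩ := exists_nat_ge t
        exact (hy n).2 t ⟨ht, hn⟩
      have hd := C2.Kelvin.hasDerivAt_flow_neg (γ := γ) hV₀1 hK₀ y t
      rw [hW₀eq _ (by linarith)] at hd
      exact hd
    · intro t ht
      obtain ⟨n, hn⟩ := exists_nat_ge t
      exact (hy n).2 t ⟨ht, hn⟩
  have htend : Tendsto (volume ∘ Sn) atTop (𝓝 0) := by
    rw [← hInter_null]
    exact tendsto_measure_iInter_atTop (fun n => (hSn_meas n).nullMeasurableSet) hSn_anti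
      ⟨0, (measure_mono inter_subset_left).trans_lt measure_ball_lt_top |>.ne⟩
  -- choose `n₀` with `volume (Sn n₀) ≤ volume (ball x₀ r) / 2`
  have hvpos : 0 < volume (ball x₀ r) := measure_ball_pos volume x₀ hr
  have hvtop : volume (ball x₀ r) < ∞ := measure_ball_lt_top
  have hhalf_pos : (0 : ℝ≥0∞) < volume (ball x₀ r) / 2 := ENNReal.half_pos hvpos.ne'
  obtain ⟨n₀, hn₀⟩ := (htend.eventually (ge_mem_nhds hhalf_pos)).exists
  -- ### the clock radius (atTop eventuality): `n₀ + 2 ≤ c′R^{2+ρ}/2` and the budget `2κ(R)/a(R) + 3R²/κ(R) ≤ c′R^{2+ρ}/2`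
  have hev : ∀ᶠ R : ℝ in atTop, Rs ≤ R ∧ (n₀ : ℝ) + 2 ≤ c' / 2 * R ^ (2 + ρ) ∧
      2 * κ R / a R + 3 * R ^ 2 / κ R ≤ c' / 2 * R ^ (2 + ρ) := by
    have hlim : Tendsto (fun R : ℝ => c' / 2 * R ^ (2 + ρ)) atTop atTop :=
      (tendsto_rpow_atTop (by linarith)).const_mul_atTop (by positivity)
    filter_upwards [eventually_ge_atTop Rs, hlim.eventually_ge_atTop ((n₀ : ℝ) + 2), hbudget (c' / 2) (by positivity)]
      with R hRs h1 h2
    exact ⟨hRs, h1, h2⟩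
  obtain ⟨R₀, hR₀⟩ := Filter.eventually_atTop.1 hev
  refine ⟨r, hr, R₀, fun R hR V' K Rbig hV' hK' hRbig hagree' => ?_⟩
  obtain ⟨hRRs, hcost1, hcost2⟩ := hR₀ R hR
  have hR1 : 1 ≤ R := le_trans hRs1 hRRs
  have hRpos : 0 < R := by linarith
  have hn₀_nonneg : (0 : ℝ) ≤ n₀ := Nat.cast_nonneg n₀
  set κR : ℝ := κ R with hκRdef
  have hκRpos : 0 < κR := hκ R hRpos
  set aR : ℝ := a R with haRdef
  have haRpos : 0 < aR := ha R hRpos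
  set τ : ℝ := 2 * κR / aR with hτdef
  have hτpos : 0 < τ := by positivity
  have hfarR : ∀ y : EuclideanSpace ℝ (Fin 3), R₁ ≤ ‖y‖ → ‖y‖ ≤ 2 * R → (1 / 2 : ℝ) < selfSimilarBernoulli γ 0 V P₀ y → curl V y ≠ 0 →
      -κR ≤ ⟪y, selfSimilarTransport γ 0 V y⟫ → ⟪y, selfSimilarTransport γ 0 V y⟫ ≤ 0 →
      aR ≤ ‖selfSimilarTransport γ 0 V y‖ ^ 2 + γ * ⟪y, selfSimilarTransport γ 0 V y⟫ +
        ⟪y, fderiv ℝ V y (selfSimilarTransport γ 0 V y)⟫ :=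
    fun y hy1 hy2 hh hc hlo hhi => hfar R y hy1 hy2 hh hc hlo hhi
  set TR : ℝ := c' * R ^ (2 + ρ) with hTRdef
  have hTR_ge : (n₀ : ℝ) + τ + 1 + 3 * R ^ 2 / κR ≤ TR := by
    have e2 : τ = 2 * κ R / a R := rfl
    have e3 : 3 * R ^ 2 / κR = 3 * R ^ 2 / κ R := rfl
    rw [e2, e3, hTRdef]
    linarith only [hcost1, hcost2]
  -- ### the main inclusion: lingering labels lie in `Sn n₀`
  have hV'1 : ContDiff ℝ 1 V' := hV'.of_le (by norm_num)
  have hW'eq : ∀ z : EuclideanSpace ℝ (Fin 3), ‖z‖ < Rbig → selfSimilarTransport γ 0 V' z = selfSimilarTransport γ 0 V z := by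
    intro z hz
    simp only [selfSimilarTransport_apply, hagree' z (by rwa [mem_ball, dist_zero_right])]
  set Φ' := ODE.evolutionMap (fun _ : ℝ => selfSimilarTransport γ 0 V') 0 with hΦ'
  have hincl : ball x₀ r ∩ {y | ∀ σ ∈ Icc 0 TR, ‖Φ' (-σ) y‖ ≤ 2 * R} ⊆ Sn n₀ := by
    rintro y ⟨hyB, hling⟩
    refine ⟨hyB, ?_⟩
    rw [mem_setOf_eq]
    by_contra hnot
    push Not at hnot
    obtain ⟨σ₀, hσ₀, hfar₀⟩ := hnot
    -- the two orbits
    set Y : ℝ → EuclideanSpace ℝ (Fin 3) := fun t => Φ' (-t) y with hYdef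
    set Y₀ : ℝ → EuclideanSpace ℝ (Fin 3) := fun t => Φ₀ (-t) y with hY₀def
    have hYd : ∀ t, HasDerivAt Y ((-1 : ℝ) • selfSimilarTransport γ 0 V' (Y t)) t :=
      fun t => C2.Kelvin.hasDerivAt_flow_neg (γ := γ) hV'1 hK' y t
    have hY₀d : ∀ t, HasDerivAt Y₀ ((-1 : ℝ) • selfSimilarTransport γ 0 V₀ (Y₀ t)) t :=
      fun t => C2.Kelvin.hasDerivAt_flow_neg (γ := γ) hV₀1 hK₀ y t
    have hYc : Continuous Y := continuous_iff_continuousAt.2 fun t => (hYd t).continuousAt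
    have hY₀c : Continuous Y₀ := continuous_iff_continuousAt.2 fun t => (hY₀d t).continuousAt
    have hY0 : Y 0 = y := by simp [hYdef, hΦ', ODE.evolutionMap_self]
    have hY₀0 : Y₀ 0 = y := by simp [hY₀def, hΦ₀, ODE.evolutionMap_self]
    -- first hit of the sphere `‖·‖ = Rs` by the cut-off orbit, at a time `σ₁ ∈ (0, σ₀]`
    have hy_lt : ‖Y₀ 0‖ < Rs := by rw [hY₀0]; linarith [hballRs y hyB]
    obtain ⟨σ₁, hσ₁pos, hσ₁le, hhit, hinside⟩ :=
      exists_first_hit (f := fun t => ‖Y₀ t‖) hσ₀.1 (hY₀c.norm.continuousOn) hy_lt hfar₀.le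
    have hσ₁n₀ : σ₁ ≤ n₀ := le_trans hσ₁le hσ₀.2
    -- on `[0, σ₁]` the cut-off orbit is a `V'`-orbit; by uniqueness `Y = Y₀` there
    have hRs_lt_Rbig : Rs + 1 ≤ Rbig := by linarith
    have hY₀V' : ∀ t ∈ Icc 0 σ₁, HasDerivAt Y₀ ((-1 : ℝ) • selfSimilarTransport γ 0 V' (Y₀ t)) t := by
      intro t ht
      have hn : ‖Y₀ t‖ ≤ Rs := hinside t ht
      have hd := hY₀d t
      rw [hW₀eq _ (by linarith), ← hW'eq _ (by linarith)] at hd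
      exact hd
    have hL' := C2.Kelvin.lipschitzWith_selfSimilarTransport (γ := γ) hV'1 hK'
    have hLneg : LipschitzWith (Real.toNNReal (|γ| + K)) (fun z => (-1 : ℝ) • selfSimilarTransport γ 0 V' z) :=
      LipschitzWith.of_dist_le_mul fun a b => by
        rw [neg_one_smul, neg_one_smul, dist_neg_neg]
        exact hL'.dist_le_mul a b
    have hEq : EqOn Y₀ Y (Icc 0 σ₁) :=
      ODE_solution_unique (v := fun _ z => (-1 : ℝ) • selfSimilarTransport γ 0 V' z)
        (fun _ => hLneg)
        (hY₀c.continuousOn) (fun t ht => (hY₀V' t (Ico_subset_Icc_self ht)).hasDerivWithinAt)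
        (hYc.continuousOn) (fun t _ => (hYd t).hasDerivWithinAt) (by rw [hY₀0, hY0])
    have hYσ₁ : ‖Y σ₁‖ = Rs := by
      rw [← hEq (right_mem_Icc.2 hσ₁pos.le)]; exact hhit
    -- on `[0, TR]` the `V'`-orbit stays in `B̄(0,2R) ⊆ ball 0 Rbig`: it is a `V`-arc there
    have hTR0 : 0 ≤ TR := by rw [hTRdef]; exact mul_nonneg hc'.le (Real.rpow_nonneg hRpos.le _)
    have hστTR : σ₁ + τ ≤ TR := by
      have : 0 ≤ 3 * R ^ 2 / κR := div_nonneg (by nlinarith only [hRpos]) hκRpos.le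
      linarith only [hTR_ge, this, hσ₁n₀]
    have hσ₁TR : σ₁ ≤ TR := by linarith only [hστTR, hτpos]
    have hYV : ∀ t ∈ Icc 0 TR, HasDerivAt Y (-(selfSimilarTransport γ 0 V (Y t))) t := by
      intro t ht
      have hn : ‖Y t‖ ≤ 2 * R := hling t ht
      have hd := hYd t
      rw [neg_one_smul, hW'eq _ (by linarith)] at hd
      exact hd
    -- in `O` (backward invariance) and vortical along the whole arc
    have hhighY : ∀ t ∈ Icc 0 TR, (1 / 2 : ℝ) < selfSimilarBernoulli γ 0 V P₀ (Y t) := by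
      intro t ht
      have hY0O : Y 0 ∈ O := by rw [hY0]; exact (hballO y hyB).1
      exact (hHO _).2 (hinv Y t ht.1 (fun s hs => hYV s ⟨hs.1, le_trans hs.2 ht.2⟩) hY0O)
    have hvortY : ∀ t ∈ Icc 0 TR, curl V (Y t) ≠ 0 := by
      intro t ht
      have h0 : curl V (Y 0) ≠ 0 := by rw [hY0]; exact (hballO y hyB).2
      exact OutflowDive.vorticityTransport ρ hρ hρh V P' hprof t ht.1 Y
        (fun s hs => hYV s ⟨hs.1, le_trans hs.2 ht.2⟩) h0
    -- ### the radial rate at the first hit is `≤ 0`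
    have hV1 : ContDiff ℝ 1 V := hU2.of_le (by norm_num)
    have hrate₁ : ⟪Y σ₁, selfSimilarTransport γ 0 V (Y σ₁)⟫ ≤ 0 := by
      by_contra hpos
      push Not at hpos
      -- `N = ‖Y‖²` has derivative `−2ℛ < 0` at `σ₁`, so it was larger just before: contradiction with `‖Y‖ ≤ Rs` on `[0, σ₁]`
      have hNd : HasDerivAt (fun s => ‖Y s‖ ^ 2) (2 * ⟪Y σ₁, -(selfSimilarTransport γ 0 V (Y σ₁))⟫) σ₁ :=
        (hYV σ₁ ⟨hσ₁pos.le, hσ₁TR⟩).norm_sq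
      have hneg : 2 * ⟪Y σ₁, -(selfSimilarTransport γ 0 V (Y σ₁))⟫ < 0 := by
        rw [inner_neg_right]; linarith
      have hev := Literature.NumberTheory.LFunctions.Nicolas.eventually_nhdsLT_lt_of_hasDerivAt_neg hNd hneg
      have hev2 : ∀ᶠ z in 𝓝[<] σ₁, 0 ≤ z := Filter.eventually_of_mem (Ioo_mem_nhdsLT hσ₁pos) fun z hz => hz.1.le
      obtain ⟨z, ⟨hz, hz0⟩, hzlt⟩ := ((hev.and hev2).and self_mem_nhdsWithin).exists
      have hzle : ‖Y z‖ ≤ Rs := by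
        rw [← hEq ⟨hz0, (le_of_lt hzlt)⟩]; exact hinside z ⟨hz0, le_of_lt hzlt⟩
      have h1 : ‖Y z‖ ^ 2 ≤ Rs ^ 2 := pow_le_pow_left₀ (norm_nonneg _) hzle 2
      rw [hYσ₁] at hz
      linarith
    -- ### phase 1: crossing the band on `[σ₁, σ₁ + τ]` — the radial rate sinks to `≤ −κR`
    have hsub1 : Icc σ₁ (σ₁ + τ) ⊆ Icc 0 TR := fun s hs => ⟨le_trans hσ₁pos.le hs.1, le_trans hs.2 hστTR⟩
    have hR₁Rs : R₁ ≤ Rs := by linarith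
    have hτa : aR * τ = 2 * κR := by
      rw [hτdef]
      field_simp
    have hmk : (0 : ℝ) + aR / 2 * (σ₁ + τ - σ₁) = κR := by
      have : aR / 2 * (σ₁ + τ - σ₁) = aR * τ / 2 := by ring
      rw [this, hτa]; ring
    have hYσ₁' : R₁ ≤ ‖Y σ₁‖ := by rw [hYσ₁]; exact hR₁Rs
    have hrate₁' : ⟪Y σ₁, selfSimilarTransport γ 0 V (Y σ₁)⟫ + 0 ≤ 0 := by rw [add_zero]; exact hrate₁
    have hslope : (0 : ℝ) ≤ aR / 2 := by positivity
    have hslope' : aR / 2 < aR := by linarith only [haRpos]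
    have hZR1 : ∀ s ∈ Icc σ₁ (σ₁ + τ), ‖Y s‖ ≤ 2 * R := fun s hs => hling s (hsub1 hs)
    have hphase1 := DriftClock.abs_band_bootstrap_shell (γ := γ) (P' := P₀) hV1 (κb := κR) (a₀ := aR) (R₁ := R₁) (R₂ := 2 * R) (h := 1 / 2)
      (t₀ := σ₁) (t₁ := σ₁ + τ) (m₀ := 0) (k := aR / 2) (le_add_of_nonneg_right hτpos.le) le_rfl hslope hslope' hmk.le hfarR
      (fun s hs => hYV s (hsub1 hs)) (fun s hs => hhighY s (hsub1 hs)) (fun s hs => hvortY s (hsub1 hs))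
      hZR1 hYσ₁' hrate₁'
    have hend1 := hphase1 (σ₁ + τ) (right_mem_Icc.2 (le_add_of_nonneg_right hτpos.le))
    have hrate₂ : ⟪Y (σ₁ + τ), selfSimilarTransport γ 0 V (Y (σ₁ + τ))⟫ + κR ≤ 0 := by
      have := hend1.2
      rwa [hmk] at this
    have hrad₂ : R₁ ≤ ‖Y (σ₁ + τ)‖ := by
      have := hend1.1; rw [hYσ₁] at this; exact le_trans hR₁Rs this
    -- ### phase 2: beyond the band forever on `[σ₁ + τ, TR]`
    have hsub2 : Icc (σ₁ + τ) TR ⊆ Icc 0 TR := fun s hs => ⟨by linarith only [hs.1, hσ₁pos.le, hτpos.le], hs.2⟩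
    have hk0 : κR + 0 * (TR - (σ₁ + τ)) ≤ κR := by rw [zero_mul, add_zero]
    have hZR2 : ∀ s ∈ Icc (σ₁ + τ) TR, ‖Y s‖ ≤ 2 * R := fun s hs => hling s (hsub2 hs)
    have hphase2 := DriftClock.abs_band_bootstrap_shell (γ := γ) (P' := P₀) hV1 (κb := κR) (a₀ := aR) (R₁ := R₁) (R₂ := 2 * R) (h := 1 / 2)
      (t₀ := σ₁ + τ) (t₁ := TR) (m₀ := κR) (k := 0) hστTR hκRpos.le le_rfl haRpos hk0 hfarR
      (fun s hs => hYV s (hsub2 hs)) (fun s hs => hhighY s (hsub2 hs)) (fun s hs => hvortY s (hsub2 hs))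
      hZR2 hrad₂ hrate₂
    -- ### square-root escape on `[σ₁ + τ, TR]`: `‖Y‖²` grows at rate `2κR`
    have hfast2 : ∀ s ∈ Icc (σ₁ + τ) TR, ⟪Y s, selfSimilarTransport γ 0 V (Y s)⟫ ≤ -κR := by
      intro s hs
      have := (hphase2 s hs).2
      rw [zero_mul, add_zero] at this
      linarith only [this]
    have hgrow := DriftClock.normSq_ge_of_inflow (γ := γ) (V := V) (Z := Y) (κ := κR)
      (fun s hs => hYV s (hsub2 hs)) hfast2 TR (right_mem_Icc.2 hστTR)
    have hlingTR : ‖Y TR‖ ≤ 2 * R := hling TR (right_mem_Icc.2 hTR0)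
    -- `‖Y (σ₁+τ)‖² + 2κR (TR − σ₁ − τ) > 4R²` since `TR − σ₁ − τ ≥ 1 + 3R²/κR`
    have hRs_le : Rs ≤ ‖Y (σ₁ + τ)‖ := by have := hend1.1; rwa [hYσ₁] at this
    have hsq : 1 ≤ ‖Y (σ₁ + τ)‖ ^ 2 := one_le_pow₀ (le_trans hRs1 hRs_le)
    have htime : 1 + 3 * R ^ 2 / κR ≤ TR - (σ₁ + τ) := by linarith only [hTR_ge, hσ₁n₀]
    have hbig : 4 * R ^ 2 < ‖Y TR‖ ^ 2 := by
      have h1 : 2 * κR * (1 + 3 * R ^ 2 / κR) ≤ 2 * κR * (TR - (σ₁ + τ)) := mul_le_mul_of_nonneg_left htime (by linarith only [hκRpos])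
      have h2' : 3 * R ^ 2 / κR * κR = 3 * R ^ 2 := div_mul_cancel₀ (3 * R ^ 2) hκRpos.ne'
      have h2 : 2 * κR * (1 + 3 * R ^ 2 / κR) = 2 * κR + 6 * R ^ 2 := by linarith only [h2']
      linarith only [hgrow, h1, h2, hsq, sq_nonneg R, hκRpos]
    have hsmall : ‖Y TR‖ ^ 2 ≤ (2 * R) ^ 2 := pow_le_pow_left₀ (norm_nonneg _) hlingTR 2
    have h4 : (2 * R) ^ 2 = 4 * R ^ 2 := by ring
    exact lt_irrefl _ (lt_of_lt_of_le hbig (hsmall.trans h4.le))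
  -- ### conclusion: measure comparison
  have hmono := measure_mono (μ := volume) hincl
  have hn₀' : volume (Sn n₀) ≤ volume (ball x₀ r) / 2 := hn₀
  have hle : volume (ball x₀ r ∩ {y | ∀ σ ∈ Icc 0 TR, ‖Φ' (-σ) y‖ ≤ 2 * R}) ≤ volume (ball x₀ r) / 2 :=
    hmono.trans hn₀'
  have hne : volume (ball x₀ r) / 2 ≠ ∞ := ENNReal.div_ne_top hvtop.ne (by norm_num)
  have := ENNReal.toReal_mono hne hle
  rwa [ENNReal.toReal_div, ENNReal.toReal_ofNat] at this

end DriftClock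

end Summit.NavierStokesRegularity.NavierStokesRegularity.Theorems.PowerGaugeEulerLiouville

end
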